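/-
Copyright: the b2b-balaban T⁴-continuum CRUX team, row NE7b OWNER lineage `t4-ne7b-p1` (gen 125). Project licence.
-/
import Summits.QuantumFields.BalabanUV.T4Continuum.Spine.NE7b.SupZdPerturbedCoarseTorusSeamRow

/-!
# THE SEAM ESTIMATE FOR PERTURBED SOLUTIONS WITH ANY BOUNDED SOURCE: for `V : ℤ^d → [−λ, Λ]`, a kernel `|K(p,q)| ≤ εe^{−γ|p−q|₁}`, ANY bounded
# source `f` on `ℤ^d` read on the fine torus of coarse period `3^k` through the window, ANY torus solution `|u_t| ≤ B_u` of
# `(H[V∘wm] + K(wm·,wm·))u_t = f∘wm` and ANY bounded `ℤ^d` solution `|u| ≤ C_u` of `(H_V + K)u = f`: for every coarse torus point `y` and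
# every `q ∈ B n (wm y)`, `|u_t(σ q) − u(q)| ≤ (C_∞εK_{γ∕2}e^{(γ∕2)d}C_u + C_∞(2 + 2(|λ|+Λ)C_∞)M)·e^{−(μ∕2)max(0, R_k(wm y)∕2)}`,
# `M = ‖f‖_∞ + 2εK_γ(B_u + C_u)` — (240)'s row argument with the indicator replaced by `f` (whose window reading IS `f` on window points):
# the torus perturbed solutions converge to the `ℤ^d` one on deep blocks, uniformly in the source's sup norm.  The input of the torus →
# `ℤ^d` limit of the perturbed COVARIANCE ((206)'s twin) (row NE7b, node U5c; (237)∕(238)∕(240) BY NAME; [folklore])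

Cell `pub-balaban`, sub-cell `t4`, spine estimate NE7b (`T4WeightBudget.RelWeightBound`; the cell's OWN estimate — NOT PRINTED in
[Bałaban 1983–89], NOT PROVED).  Crux-route work under `Spine/NE7b/` by the row OWNER (`t4-ne7b-p1` gen 125, file (247)) under FREEZE
(0)'s crux-prover clause; NOTHING of Bałaban's is named as a Lean object, valued or asserted; no `T4Continuum/Support` leaf typed; no `def`,
no notation; zero `sorry`.  Imports (BY NAME): the OWNER's (240) `…SupZdPerturbedCoarseTorusSeamRow` (`truncation_defect_depth`,
`far_from_shallow`; through it (237) `zd_perturbed_data_agreement`, (238) `lift_truncated_equation`, `column_truncated_equation`,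
`truncated_kernel_decay`, (197) `windowMap_siteOf_of_deep_block`, `torusNorm_eq_l1`, (222) `K_pos`, (27) `mem_B`).

WHY (located).  (239)∕(240) compared the torus and `ℤ^d` BLOCK COLUMNS (indicator sources); the covariance `C_Kf = u^K − Σ″m^K(b″)h^K_{b″}`
((221)∕(225)) involves the solution `u^K = G_Kf` of a general block-supported source, whose torus counterpart solves the window-read
equation.  The comparison is (240) verbatim with a simpler source bookkeeping: on a deep block `wm σ p = p`, so `f(wm σ p) = f(p)` — no
indicator identity is needed, and no support hypothesis on `f` either.

WHAT IS PROVED ([folklore]): **`zd_perturbed_solution_seam_row`** (`∃ C₀ C_P δ₀ > 0` ((237)'s): for ALL `n, k`, `V`, rates∕sizes under the two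
smallness conditions, kernels of the class, ANY bounded `f`, ANY bounded torus solution `u_t` of the window-read equation and ANY bounded
`ℤ^d` solution `u`: the pointwise row bound on the block of `wm y` for ALL `y`); §2 toy.

HONEST (what this is NOT).  The solution-level seam only; the covariance's torus limit (finite torus sums of responses × block means →
the `ℤ^d` series, Tannery as in (206)∕(244)) is the sequel; scalar skeleton ((A3), NC-NE7b-α UNRULED); nothing of the covariant
propagators of [B4]–[B6]; nothing of Bałaban's asserted.  BY-NAME EFFECT ON THE WALL: NONE.  NE7b NOT PRINTED ∕ NOT PROVED; spine PROVED
0∕9; rung (B)+1 — the programme's measures remain FINITE-torus statements; NOT the mass gap, NOT Clay.  HONEST DEPENDENCY: continuum YM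
on T⁴ ⇐ BetaPertH ∧ nine spine estimates (0∕9 proved); BetaPertH ⇐ (D1) ∧ (D4) ∧ CAP+tail; G-an2-4 gates asym, D1 and NE2∕3∕4.
-/

set_option autoImplicit false

noncomputable section

namespace Summit.QuantumFields.BalabanUV.T4Continuum.NE7b.SupZdPerturbedSolutionTorusSeam

open Real Filter Topology
open Literature.MathematicalPhysics.QuantumFieldTheory.Balaban1983to89
open B6QGQLower276 (X e blk B mem_B)
open Beta (Site siteOf windowMap siteOf_windowMap)
open SupZdPerturbedColumn (K_pos)
open SupZdCoarseTorusSeam (windowMap_siteOf_of_deep_block torusNorm_eq_l1)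
open SupZdPerturbedDataAgreement (zd_perturbed_data_agreement)
open SupZdPerturbedTorusLift (lift_truncated_equation column_truncated_equation truncated_kernel_decay)
open SupZdPerturbedCoarseTorusSeamRow (truncation_defect_depth far_from_shallow)

variable {d : ℕ}

/-! ## §1. THE END: the solution seam for any bounded source -/

/-- **HEADLINE — THE SEAM ESTIMATE FOR PERTURBED SOLUTIONS WITH ANY BOUNDED SOURCE.**  `d ≥ 3`, `a > 0`, `λ < min(2,a)`, `Λ ≥ 0` ⟹
`∃ C₀ C_P δ₀ > 0` such that for ALL `n, k`, `V : ℤ^d → [−λ, Λ]`, rates `0 < μ < min(δ₀, γ)`, sizes `ε ≥ 0` under the two smallness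
conditions, kernels `|K(p,q)| ≤ εe^{−γ|p−q|₁}`, ANY `|f| ≤ M_f` on `ℤ^d`, ANY torus function `|u_t| ≤ B_u` solving
`(H[V∘wm] + K(wm·,wm·))u_t = f∘wm` on `Site d ((n+1)3^k)` and ANY `|u| ≤ C_u` solving `(H_V + K)u = f` on `ℤ^d`: for ALL coarse `y` and all
`q ∈ B n (wm y)`, `|u_t(σ q) − u(q)| ≤ (C_∞εK_{γ∕2}e^{(γ∕2)d}C_u + C_∞(2 + 2(|λ|+Λ)C_∞)(M_f + 2εK_γ(B_u + C_u)))·e^{−(μ∕2)max(0, R_k(y)∕2)}`,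
`C_∞ = 2C_PK_{δ₀−μ}K_{μ∕2}`, `R_k(y) = 3^k∕2 − 2 − Σ_i|y_i|`. [folklore] -/
theorem zd_perturbed_solution_seam_row (hd : 3 ≤ d) (a : ℝ) (ha : 0 < a) {lam Lam : ℝ} (hlam : lam < min 2 a) (hLam : 0 ≤ Lam) :
    ∃ C₀ CP δ₀ : ℝ, 0 < C₀ ∧ 0 < CP ∧ 0 < δ₀ ∧ ∀ (n k : ℕ) (V : X d → ℝ), (∀ p, -lam ≤ V p) → (∀ p, V p ≤ Lam) →
      ∀ (ε γ μ : ℝ), 0 ≤ ε → 0 < μ → μ < δ₀ → μ < γ →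
      ε * (2 * (1 - exp (-γ))⁻¹) ^ d * C₀ ≤ 1 / 2 →
      (CP * (2 * (1 - exp (-(δ₀ - μ)))⁻¹) ^ d) * (ε * exp (μ * d) * (2 * (1 - exp (-(γ - μ)))⁻¹) ^ d) ≤ 1 / 2 →
      ∀ (K : X d → X d → ℝ), (∀ p q, |K p q| ≤ ε * exp (-(γ * ∑ i, (((p i - q i).natAbs : ℕ) : ℝ)))) →
      ∀ (f : X d → ℝ) (Mf : ℝ), (∀ p, |f p| ≤ Mf) →
      ∀ (ut : Site d ((n + 1) * 3 ^ k) → ℝ) (Bu : ℝ), (∀ x, |ut x| ≤ Bu) →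
      (∀ x, ((n : ℝ) + 1) ^ 2 * ∑ μ', (2 * ut x - ut (x + siteOf d ((n + 1) * 3 ^ k) (e μ')) - ut (x - siteOf d ((n + 1) * 3 ^ k) (e μ')))
        + a / ((n : ℝ) + 1) ^ d * ∑ q ∈ B n (blk n (windowMap d ((n + 1) * 3 ^ k) x)), ut (siteOf d ((n + 1) * 3 ^ k) q)
        + V (windowMap d ((n + 1) * 3 ^ k) x) * ut x
        + ∑ z, K (windowMap d ((n + 1) * 3 ^ k) x) (windowMap d ((n + 1) * 3 ^ k) z) * ut z
        = f (windowMap d ((n + 1) * 3 ^ k) x)) →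
      ∀ (u : X d → ℝ) (Cu : ℝ), (∀ q, |u q| ≤ Cu) →
      (∀ p, ((n : ℝ) + 1) ^ 2 * ∑ μ', (2 * u p - u (p + e μ') - u (p - e μ'))
        + a / ((n : ℝ) + 1) ^ d * ∑ q ∈ B n (blk n p), u q + V p * u p + ∑' q : X d, K p q * u q = f p) →
      ∀ (y : Site d (3 ^ k)) (q : X d), q ∈ B n (windowMap d (3 ^ k) y) →
        |ut (siteOf d ((n + 1) * 3 ^ k) q) - u q|
          ≤ ((2 * (CP * (2 * (1 - exp (-(δ₀ - μ)))⁻¹) ^ d) * (2 * (1 - exp (-(μ / 2)))⁻¹) ^ d)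
                * (ε * (2 * (1 - exp (-(γ / 2)))⁻¹) ^ d * exp (γ / 2 * d) * Cu)
              + (2 * (CP * (2 * (1 - exp (-(δ₀ - μ)))⁻¹) ^ d) * (2 * (1 - exp (-(μ / 2)))⁻¹) ^ d)
                * ((2 + 2 * (|lam| + Lam) * (2 * (CP * (2 * (1 - exp (-(δ₀ - μ)))⁻¹) ^ d) * (2 * (1 - exp (-(μ / 2)))⁻¹) ^ d))
                  * (Mf + 2 * (ε * (2 * (1 - exp (-γ))⁻¹) ^ d) * (Bu + Cu))))
            * exp (-(μ / 2 * max 0 ((((3 ^ k : ℕ) : ℝ) / 2 - 2 - ∑ i, ((((y i).valMinAbs).natAbs : ℕ) : ℝ)) / 2))) := by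
  classical
  obtain ⟨C₀, CP, δ₀, hC₀, hCP, hδ₀, H237⟩ := zd_perturbed_data_agreement (d := d) hd a ha hlam hLam
  refine ⟨C₀, CP, δ₀, hC₀, hCP, hδ₀, ?_⟩
  intro n k V hV hV' ε γ μ hε hμ hμδ hμγ hs1 hs2 K hK f Mf hfM ut Bu hutB hut u Cu huB hu y q hq
  have hγ : 0 < γ := hμ.trans hμγ
  have hK0 : 0 < (2 * (1 - exp (-(δ₀ - μ)))⁻¹) ^ d := K_pos (d := d) (sub_pos.2 hμδ)
  have hKh : 0 < (2 * (1 - exp (-(μ / 2)))⁻¹) ^ d := K_pos (d := d) (by linarith)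
  have hKγ : 0 < (2 * (1 - exp (-γ))⁻¹) ^ d := K_pos (d := d) hγ
  have hKγ2 : 0 < (2 * (1 - exp (-(γ / 2)))⁻¹) ^ d := K_pos (d := d) (by linarith)
  obtain ⟨Cs, hCs⟩ : ∃ Cs : ℝ, Cs = 2 * (CP * (2 * (1 - exp (-(δ₀ - μ)))⁻¹) ^ d) * (2 * (1 - exp (-(μ / 2)))⁻¹) ^ d := ⟨_, rfl⟩
  obtain ⟨Kγ, hKγd⟩ : ∃ Kγ : ℝ, Kγ = (2 * (1 - exp (-γ))⁻¹) ^ d := ⟨_, rfl⟩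
  obtain ⟨E, hE⟩ : ∃ E : ℝ, E = ε * (2 * (1 - exp (-(γ / 2)))⁻¹) ^ d * exp (γ / 2 * d) * Cu := ⟨_, rfl⟩
  have hCs0 : 0 < Cs := by rw [hCs]; positivity
  have hKγ0 : 0 < Kγ := by rw [hKγd]; exact hKγ
  have hBu : 0 ≤ Bu := (abs_nonneg _).trans (hutB 0)
  have hCu : 0 ≤ Cu := (abs_nonneg _).trans (huB 0)
  have hMf : 0 ≤ Mf := (abs_nonneg _).trans (hfM 0)
  have hE0 : 0 ≤ E := by rw [hE]; positivity
  obtain ⟨b₀, hb₀⟩ : ∃ b₀ : X d, b₀ = windowMap d (3 ^ k) y := ⟨_, rfl⟩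
  obtain ⟨D₀, hD₀⟩ : ∃ D₀ : ℝ, D₀ = max 0 ((((3 ^ k : ℕ) : ℝ) / 2 - 2 - ∑ j, (((b₀ j).natAbs : ℕ) : ℝ)) / 2) := ⟨_, rfl⟩
  have hD₀0 : 0 ≤ D₀ := by rw [hD₀]; exact le_max_left _ _
  have hDy : max 0 ((((3 ^ k : ℕ) : ℝ) / 2 - 2 - ∑ i, ((((y i).valMinAbs).natAbs : ℕ) : ℝ)) / 2) = D₀ := by
    rw [hD₀, hb₀, torusNorm_eq_l1 k y]
  rw [hDy, ← hCs, ← hKγd, ← hE]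
  rw [← hb₀] at hq
  have hV₁ : ∀ p : X d, -lam ≤ V (windowMap d ((n + 1) * 3 ^ k) (siteOf d ((n + 1) * 3 ^ k) p)) := fun p => hV _
  have hV₁' : ∀ p : X d, V (windowMap d ((n + 1) * 3 ^ k) (siteOf d ((n + 1) * 3 ^ k) p)) ≤ Lam := fun p => hV' _
  have H := H237 n (fun p => V (windowMap d ((n + 1) * 3 ^ k) (siteOf d ((n + 1) * 3 ^ k) p))) V hV₁ hV₁' hV hV' ε γ μ hε hμ hμδ hμγ
    hs1 hs2
  simp only [← hCs] at H
  -- the two truncated-kernel equations ((238))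
  have hut' : ∀ x, ((n : ℝ) + 1) ^ 2 * ∑ μ', (2 * ut x - ut (x + siteOf d ((n + 1) * 3 ^ k) (e μ'))
      - ut (x - siteOf d ((n + 1) * 3 ^ k) (e μ')))
      + a / ((n : ℝ) + 1) ^ d * ∑ q ∈ B n (blk n (windowMap d ((n + 1) * 3 ^ k) x)), ut (siteOf d ((n + 1) * 3 ^ k) q)
      + (fun x => V (windowMap d ((n + 1) * 3 ^ k) x)) x * ut x
      + ∑ z, K (windowMap d ((n + 1) * 3 ^ k) x) (windowMap d ((n + 1) * 3 ^ k) z) * ut z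
      = (fun x => f (windowMap d ((n + 1) * 3 ^ k) x)) x := fun x => hut x
  obtain ⟨g₁, hg₁W, hg₁B, hu₁⟩ := lift_truncated_equation n a (3 ^ k) hγ K hK (fun x => V (windowMap d ((n + 1) * 3 ^ k) x)) ut
    (fun x => f (windowMap d ((n + 1) * 3 ^ k) x)) hutB hut'
  obtain ⟨hu₂, hg₂B⟩ := column_truncated_equation n a ((n + 1) * 3 ^ k) hγ K hK V u f huB hu
  rw [← hKγd] at hg₁B
  -- the source bounds
  have hf₁ : ∀ p : X d, |f (windowMap d ((n + 1) * 3 ^ k) (siteOf d ((n + 1) * 3 ^ k) p)) + g₁ p|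
      ≤ Mf + 2 * (ε * Kγ) * (Bu + Cu) := by
    intro p
    refine (abs_add_le _ _).trans (add_le_add (hfM _) ((hg₁B p).trans ?_))
    nlinarith [mul_nonneg (mul_nonneg hε hKγ0.le) hCu]
  have hf₂ : ∀ p : X d, |f p
      + -∑' q : X d, (if windowMap d ((n + 1) * 3 ^ k) (siteOf d ((n + 1) * 3 ^ k) q) = q then 0 else K p q) * u q|
      ≤ Mf + 2 * (ε * Kγ) * (Bu + Cu) := by
    intro p
    have h0 := hg₂B 0 Cu 0 0 le_rfl (fun q => by rw [zero_mul, neg_zero, exp_zero, mul_one]; exact huB q) (fun q _ => by positivity) p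
    rw [mul_zero, neg_zero, exp_zero, mul_one, ← hKγd] at h0
    refine (abs_add_le _ _).trans (add_le_add (hfM p) (h0.trans ?_))
    nlinarith [mul_nonneg (mul_nonneg hε hKγ0.le) hBu, mul_nonneg (mul_nonneg hε hKγ0.le) hCu]
  -- on the deep blocks of depth `≥ D₀` the potentials agree and the sources are `Ee^{−(γ/2)D₀}`-close
  have hA : ∀ p : X d, blk n p ∈ {b : X d | (∀ i, 2 * |b i| + 4 < ((3 ^ k : ℕ) : ℤ)) ∧
        D₀ ≤ ((3 ^ k : ℕ) : ℝ) / 2 - 2 - ∑ j, (((b j).natAbs : ℕ) : ℝ)} →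
      V (windowMap d ((n + 1) * 3 ^ k) (siteOf d ((n + 1) * 3 ^ k) p)) = V p ∧
      |(f (windowMap d ((n + 1) * 3 ^ k) (siteOf d ((n + 1) * 3 ^ k) p)) + g₁ p)
        - (f p + -∑' q : X d, (if windowMap d ((n + 1) * 3 ^ k) (siteOf d ((n + 1) * 3 ^ k) q) = q then 0 else K p q) * u q)|
        ≤ E * exp (-(γ / 2 * D₀)) := by
    intro p hp
    simp only [Set.mem_setOf_eq] at hp
    have hpW := windowMap_siteOf_of_deep_block n k p hp.1
    refine ⟨by rw [hpW], ?_⟩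
    rw [hpW, hg₁W p hpW]
    have e' : f p + 0 - (f p + -∑' q : X d, (if windowMap d ((n + 1) * 3 ^ k) (siteOf d ((n + 1) * 3 ^ k) q) = q then 0
        else K p q) * u q)
        = -(-∑' q : X d, (if windowMap d ((n + 1) * 3 ^ k) (siteOf d ((n + 1) * 3 ^ k) q) = q then 0 else K p q) * u q) := by ring
    rw [e', abs_neg]
    refine (truncation_defect_depth n k hε hγ K hK u huB p).trans ?_
    rw [← hE]
    exact mul_le_mul_of_nonneg_left (exp_le_exp.2 (neg_le_neg (mul_le_mul_of_nonneg_left hp.2 (by linarith)))) hE0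
  -- (237) at depth `D₀`
  have key := H (fun p q => if windowMap d ((n + 1) * 3 ^ k) (siteOf d ((n + 1) * 3 ^ k) q) = q then K p q else 0)
    (fun p q => (truncated_kernel_decay ((n + 1) * 3 ^ k) K hK p q).1)
    (fun p => f (windowMap d ((n + 1) * 3 ^ k) (siteOf d ((n + 1) * 3 ^ k) p)) + g₁ p)
    (fun p => f p + -∑' q : X d, (if windowMap d ((n + 1) * 3 ^ k) (siteOf d ((n + 1) * 3 ^ k) q) = q then 0 else K p q) * u q)
    (Mf + 2 * (ε * Kγ) * (Bu + Cu)) hf₁ hf₂ (fun p => ut (siteOf d ((n + 1) * 3 ^ k) p)) u Bu Cu (fun p => hutB _) huB hu₁ hu₂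
    {b : X d | (∀ i, 2 * |b i| + 4 < ((3 ^ k : ℕ) : ℤ)) ∧ D₀ ≤ ((3 ^ k : ℕ) : ℝ) / 2 - 2 - ∑ j, (((b j).natAbs : ℕ) : ℝ)}
    (E * exp (-(γ / 2 * D₀))) (by positivity) hA
  have h := key q D₀ (fun c' hc' => by
    rw [mem_B.1 hq, hD₀]
    refine far_from_shallow k b₀ c' fun h => hc' ?_
    rw [← hD₀] at h
    simpa only [Set.mem_setOf_eq] using h)
  have hexp : exp (-(γ / 2 * D₀)) ≤ exp (-(μ / 2 * D₀)) := exp_le_exp.2 (by nlinarith)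
  calc _ ≤ Cs * (E * exp (-(γ / 2 * D₀))) + Cs * ((2 + 2 * (|lam| + Lam) * Cs) * (Mf + 2 * (ε * Kγ) * (Bu + Cu)))
        * exp (-(μ / 2 * D₀)) := h
    _ ≤ Cs * (E * exp (-(μ / 2 * D₀))) + Cs * ((2 + 2 * (|lam| + Lam) * Cs) * (Mf + 2 * (ε * Kγ) * (Bu + Cu)))
        * exp (-(μ / 2 * D₀)) := by gcongr
    _ = _ := by ring

/-! ## §2. Toy -/

/-- Toy (`d = 3`, `a = 1`, `λ = 0`, `Λ = 1`): the constants of the solution seam exist. -/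
example : ∃ C₀ CP δ₀ : ℝ, 0 < C₀ ∧ 0 < CP ∧ 0 < δ₀ :=
  let ⟨C₀, CP, δ₀, h1, h2, h3, _⟩ := zd_perturbed_solution_seam_row (d := 3) le_rfl 1 one_pos (lam := 0) (Lam := 1)
    (by rw [min_eq_right (by norm_num : (1 : ℝ) ≤ 2)]; norm_num) zero_le_one
  ⟨C₀, CP, δ₀, h1, h2, h3⟩

end Summit.QuantumFields.BalabanUV.T4Continuum.NE7b.SupZdPerturbedSolutionTorusSeam
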